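import Summits.SmoothPoincare4.SmoothPoincare4.Theorems.WeakReductionDescentDependentTripleGenusThreeStandardSketchReduction

/-!
# Crux `WeakReductionDescent.DependentTripleGenusThreeStandard` (stmt-SmoothPoincare4-18000), line
# `Sketch`, skeleton v5: the reduction of the crux to its FIVE registered stubs

Helper file (`--supports stmt-SmoothPoincare4-18000`), continuation of
`WeakReductionDescentDependentTripleGenusThreeStandardSketchReduction.lean` (p166686, skeleton v4:
crux ⇐ four stubs).  Skeleton v5 (`Cruxes/DependentTripleGenusThreeStandard/Lines/Sketch.lean`)
splits v4's stub 3 ("a separating pair of a dependent triple of a `(3; 1,1,1)`-trisected homotopy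
4-sphere makes the trisection weakly reducible" — Aranda–Zupan 2025 §7 configurations (1)–(2),
arXiv:2503.04607 pp. 24–25) BY CONFIGURATION, told apart by the presence of an ANNULAR CHART of
the central surface between the two curves:

* stub 3a `stub_boundsDisc_of_annularChart` (generic `(g; k)`, any handlebody `H_p`): compressing
  discs transport across an annular chart — configuration (1) "two of the curves are homotopic";
* stub 3b `stub_separatingPairWeaklyReducible_of_noAnnularChart`: configuration (2) "homologous,
  not homotopic" (no annular chart) ⇒ weakly reducible — the printed use of Lemma 3.8 (p. 10).

This file proves the glue `helper_separatingPairWeaklyReducible_of_stubs` (3a → 3b → v4's stub 3: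
in configuration (1) the transported disc makes `f j` compress in `H_i` and `H_j`, and the third
curve completes a weak reduction, `Trisection.isWeaklyReducible_of_boundsDisc_two`) and the v5
REDUCTION `helper_dependentTripleGenusThreeStandard_of_five` (crux BY NAME ⇐ the five registered
stubs as explicit hypotheses), by `helper_dependentTripleGenusThreeStandard_of_four`.
No definition, no named fact; pure logic over proved tree theorems.

Reference: R. Aranda, A. Zupan, arXiv:2503.04607 (2025), §7 pp. 24–25 (configurations (1)–(3)).
-/

-- the registered namespace `Summit.SmoothPoincare4.SmoothPoincare4.Theorems…` repeats a component
set_option linter.dupNamespace false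

noncomputable section

open scoped Manifold ContDiff Topology ContinuousMap
open Set
open Literature.Topology.FourManifolds
open Literature.Topology.FourManifolds.Trisection

namespace Summit.SmoothPoincare4.SmoothPoincare4.Theorems

/-- **REGISTERED helper (line `Sketch`, v5): v4's stub 3 from stubs 3a and 3b** — if an annular
chart of the central surface joins `f i` and `f j` (configuration (1)), stub 3a transports the
`H_i`-disc of `f i` to `f j`, which then compresses in both `H_i` and `H_j`, and with the third
curve `f l` this is a weak reduction (`Trisection.isWeaklyReducible_of_boundsDisc_two`); otherwise
(configuration (2)) stub 3b applies verbatim. [cite: ArandaZupan2025, §7 (pp. 24–25), configurations (1)–(2)] -/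
theorem helper_separatingPairWeaklyReducible_of_stubs :
    (∀ (M : Type) [TopologicalSpace M] [T2Space M] [SecondCountableTopology M] [ChartedSpace (EuclideanSpace ℝ (Fin 4)) M] [IsManifold (𝓡 4) ∞ M], ∀ (g : ℕ) (k : Fin 3 → ℕ) (T : Fin 3 → Set M), IsGKTrisection M g k T → ∀ (p : Fin 3) (a b : Set M), IsCurve T a → IsCurve T b → (∃ (ψ : EuclideanSpace ℝ (Fin 2) → M) (rlo r₀ r₁ rhi : ℝ), 0 < r₀ ∧ 0 < r₁ ∧ rlo < r₀ ∧ rlo < r₁ ∧ r₀ < rhi ∧ r₁ < rhi ∧ ContMDiffOn (𝓡 2) (𝓡 4) ∞ ψ {x | rlo < ‖x‖ ∧ ‖x‖ < rhi} ∧ Set.InjOn ψ {x | rlo < ‖x‖ ∧ ‖x‖ < rhi} ∧ (∀ x : EuclideanSpace ℝ (Fin 2), rlo < ‖x‖ → ‖x‖ < rhi → Function.Injective (mfderiv (𝓡 2) (𝓡 4) ψ x)) ∧ ψ '' {x | rlo < ‖x‖ ∧ ‖x‖ < rhi} ⊆ centralSurfaceSet T ∧ (Set.range fun x : Metric.sphere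 (0 : EuclideanSpace ℝ (Fin 2)) 1 => ψ (r₀ • (x : EuclideanSpace ℝ (Fin 2)))) = a ∧ (Set.range fun x : Metric.sphere (0 : EuclideanSpace ℝ (Fin 2)) 1 => ψ (r₁ • (x : EuclideanSpace ℝ (Fin 2)))) = b) → BoundsDisc T (spineHandlebody T p) a → BoundsDisc T (spineHandlebody T p) b) →
    (∀ (M : Type) [TopologicalSpace M] [T2Space M] [SecondCountableTopology M] [ChartedSpace (EuclideanSpace ℝ (Fin 4)) M] [IsManifold (𝓡 4) ∞ M], M ≃ₕ (Metric.sphere (0 : EuclideanSpace ℝ (Fin 5)) 1) → ∀ T : Fin 3 → Set M, IsGKTrisection M 3 (fun _ => 1) T → ∀ f : Fin 3 → Set M, (∀ i, IsCurve T (f i)) → (Pairwise fun i j => Disjoint (f i) (f j)) → (∀ i, IsNonSeparating T (f i)) → (∀ i, BoundsDisc T (spineHandlebody T i) (f i)) → ¬ IsPreconnected (centralSurfaceSet T \ ⋃ i, f i) → ∀ i j : Fin 3, i ≠ j → ¬ IsConnected (centralSurfaceSet T \ (f i ∪ f j)) → ¬ (∃ (ψ : EuclideanSpace ℝ (Fin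 2) → M) (rlo r₀ r₁ rhi : ℝ), 0 < r₀ ∧ 0 < r₁ ∧ rlo < r₀ ∧ rlo < r₁ ∧ r₀ < rhi ∧ r₁ < rhi ∧ ContMDiffOn (𝓡 2) (𝓡 4) ∞ ψ {x | rlo < ‖x‖ ∧ ‖x‖ < rhi} ∧ Set.InjOn ψ {x | rlo < ‖x‖ ∧ ‖x‖ < rhi} ∧ (∀ x : EuclideanSpace ℝ (Fin 2), rlo < ‖x‖ → ‖x‖ < rhi → Function.Injective (mfderiv (𝓡 2) (𝓡 4) ψ x)) ∧ ψ '' {x | rlo < ‖x‖ ∧ ‖x‖ < rhi} ⊆ centralSurfaceSet T ∧ (Set.range fun x : Metric.sphere (0 : EuclideanSpace ℝ (Fin 2)) 1 => ψ (r₀ • (x : EuclideanSpace ℝ (Fin 2)))) = f i ∧ (Set.range fun x : Metric.sphere (0 : EuclideanSpace ℝ (Fin 2)) 1 => ψ (r₁ • (x : EuclideanSpace ℝ (Fin 2)))) = f j) → IsWeaklyReducible T) →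
    ∀ (M : Type) [TopologicalSpace M] [T2Space M] [SecondCountableTopology M] [ChartedSpace (EuclideanSpace ℝ (Fin 4)) M] [IsManifold (𝓡 4) ∞ M], M ≃ₕ (Metric.sphere (0 : EuclideanSpace ℝ (Fin 5)) 1) → ∀ T : Fin 3 → Set M, IsGKTrisection M 3 (fun _ => 1) T → ∀ f : Fin 3 → Set M, (∀ i, IsCurve T (f i)) → (Pairwise fun i j => Disjoint (f i) (f j)) → (∀ i, IsNonSeparating T (f i)) → (∀ i, BoundsDisc T (spineHandlebody T i) (f i)) → ¬ IsPreconnected (centralSurfaceSet T \ ⋃ i, f i) → ∀ i j : Fin 3, i ≠ j → ¬ IsConnected (centralSurfaceSet T \ (f i ∪ f j)) → IsWeaklyReducible T := by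
  intro h3a h3b M _ _ _ _ _ e T hT f hcur hdis hns hbd hdep i j hij hsep
  have third : ∀ i j : Fin 3, i ≠ j → ∃ l : Fin 3, l ≠ i ∧ l ≠ j := by decide
  obtain ⟨l, hli, hlj⟩ := third i j hij
  by_cases hA : (∃ (ψ : EuclideanSpace ℝ (Fin 2) → M) (rlo r₀ r₁ rhi : ℝ),
        0 < r₀ ∧ 0 < r₁ ∧ rlo < r₀ ∧ rlo < r₁ ∧ r₀ < rhi ∧ r₁ < rhi ∧
        ContMDiffOn (𝓡 2) (𝓡 4) ∞ ψ {x | rlo < ‖x‖ ∧ ‖x‖ < rhi} ∧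
        Set.InjOn ψ {x | rlo < ‖x‖ ∧ ‖x‖ < rhi} ∧
        (∀ x : EuclideanSpace ℝ (Fin 2), rlo < ‖x‖ → ‖x‖ < rhi →
          Function.Injective (mfderiv (𝓡 2) (𝓡 4) ψ x)) ∧
        ψ '' {x | rlo < ‖x‖ ∧ ‖x‖ < rhi} ⊆ centralSurfaceSet T ∧
        (Set.range fun x : Metric.sphere (0 : EuclideanSpace ℝ (Fin 2)) 1 =>
          ψ (r₀ • (x : EuclideanSpace ℝ (Fin 2)))) = f i ∧
        (Set.range fun x : Metric.sphere (0 : EuclideanSpace ℝ (Fin 2)) 1 =>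
          ψ (r₁ • (x : EuclideanSpace ℝ (Fin 2)))) = f j)
  · -- configuration (1): `f j` also compresses in `H_i`
    have hb : BoundsDisc T (spineHandlebody T i) (f j) :=
      h3a M 3 (fun _ => 1) T hT i (f i) (f j) (hcur i) (hcur j) hA (hbd i)
    exact isWeaklyReducible_of_boundsDisc_two (p := l) (i := i) (j := j) hij hli.symm hlj.symm
      (hcur l) (hcur j) (hdis hlj) (hns l) (hns j) (hbd l) hb (hbd j)
  · exact h3b M e T hT f hcur hdis hns hbd hdep
      i j hij hsep hA

/-- **REGISTERED helper — THE REDUCTION OF THE LINE, skeleton v5 (crux ⇐ five stubs, sorry-free).**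
The route item `DependentTripleGenusThreeStandard` from five explicit hypotheses, verbatim the five
registered stubs: (1) the Thm. 1.3 fact `az2025_weaklyReducible_genusThree_homotopySphere_gk.{0}`
(= sibling item `GenusThreeBase`); (2) `msz_trisection_classification_gk.{0}` (MSZ16 Thm. 1.2);
(3a) disc transport across an annular chart; (3b) configuration (2) ⇒ weakly reducible;
(4) the loop-partner step.  Proof: `helper_dependentTripleGenusThreeStandard_of_four` (p166686)
with stub 3 supplied by `helper_separatingPairWeaklyReducible_of_stubs`.
[cite: ArandaZupan2025, Thm. 1.3, Thm. 1.4 and Cor. 1.5 (p. 2), §7 (pp. 24–26)] [cite: MeierSchirmerZupan2016, Thm. 1.2] -/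
theorem helper_dependentTripleGenusThreeStandard_of_five :
    Literature.Barriers.SmoothPoincare4.az2025_weaklyReducible_genusThree_homotopySphere_gk.{0} →
    msz_trisection_classification_gk.{0} →
    (∀ (M : Type) [TopologicalSpace M] [T2Space M] [SecondCountableTopology M] [ChartedSpace (EuclideanSpace ℝ (Fin 4)) M] [IsManifold (𝓡 4) ∞ M], ∀ (g : ℕ) (k : Fin 3 → ℕ) (T : Fin 3 → Set M), IsGKTrisection M g k T → ∀ (p : Fin 3) (a b : Set M), IsCurve T a → IsCurve T b → (∃ (ψ : EuclideanSpace ℝ (Fin 2) → M) (rlo r₀ r₁ rhi : ℝ), 0 < r₀ ∧ 0 < r₁ ∧ rlo < r₀ ∧ rlo < r₁ ∧ r₀ < rhi ∧ r₁ < rhi ∧ ContMDiffOn (𝓡 2) (𝓡 4) ∞ ψ {x | rlo < ‖x‖ ∧ ‖x‖ < rhi} ∧ Set.InjOn ψ {x | rlo < ‖x‖ ∧ ‖x‖ < rhi} ∧ (∀ x : EuclideanSpace ℝ (Fin 2), rlo < ‖x‖ → ‖x‖ < rhi → Function.Injective (mfderiv (𝓡 2) (𝓡 4) ψ x)) ∧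 ψ '' {x | rlo < ‖x‖ ∧ ‖x‖ < rhi} ⊆ centralSurfaceSet T ∧ (Set.range fun x : Metric.sphere (0 : EuclideanSpace ℝ (Fin 2)) 1 => ψ (r₀ • (x : EuclideanSpace ℝ (Fin 2)))) = a ∧ (Set.range fun x : Metric.sphere (0 : EuclideanSpace ℝ (Fin 2)) 1 => ψ (r₁ • (x : EuclideanSpace ℝ (Fin 2)))) = b) → BoundsDisc T (spineHandlebody T p) a → BoundsDisc T (spineHandlebody T p) b) →
    (∀ (M : Type) [TopologicalSpace M] [T2Space M] [SecondCountableTopology M] [ChartedSpace (EuclideanSpace ℝ (Fin 4)) M] [IsManifold (𝓡 4) ∞ M], M ≃ₕ (Metric.sphere (0 : EuclideanSpace ℝ (Fin 5)) 1) → ∀ T : Fin 3 → Set M, IsGKTrisection M 3 (fun _ => 1) T → ∀ f : Fin 3 → Set M, (∀ i, IsCurve T (f i)) → (Pairwise fun i j => Disjoint (f i) (f j)) → (∀ i, IsNonSeparating T (f i)) → (∀ i, BoundsDisc T (spineHandlebody T i) (f i)) → ¬ IsPreconnected (centralSurfaceSet T \ ⋃ i, f i) → ∀ i j : Fin 3,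 i ≠ j → ¬ IsConnected (centralSurfaceSet T \ (f i ∪ f j)) → ¬ (∃ (ψ : EuclideanSpace ℝ (Fin 2) → M) (rlo r₀ r₁ rhi : ℝ), 0 < r₀ ∧ 0 < r₁ ∧ rlo < r₀ ∧ rlo < r₁ ∧ r₀ < rhi ∧ r₁ < rhi ∧ ContMDiffOn (𝓡 2) (𝓡 4) ∞ ψ {x | rlo < ‖x‖ ∧ ‖x‖ < rhi} ∧ Set.InjOn ψ {x | rlo < ‖x‖ ∧ ‖x‖ < rhi} ∧ (∀ x : EuclideanSpace ℝ (Fin 2), rlo < ‖x‖ → ‖x‖ < rhi → Function.Injective (mfderiv (𝓡 2) (𝓡 4) ψ x)) ∧ ψ '' {x | rlo < ‖x‖ ∧ ‖x‖ < rhi} ⊆ centralSurfaceSet T ∧ (Set.range fun x : Metric.sphere (0 : EuclideanSpace ℝ (Fin 2)) 1 => ψ (r₀ • (x : EuclideanSpace ℝ (Fin 2)))) = f i ∧ (Set.range fun x : Metric.sphere (0 : EuclideanSpace ℝ (Fin 2)) 1 => ψ (r₁ • (x : EuclideanSpace ℝ (Fin 2)))) = f j) → IsWeaklyReducible T) →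
    (∀ (M : Type) [TopologicalSpace M] [T2Space M] [SecondCountableTopology M] [ChartedSpace (EuclideanSpace ℝ (Fin 4)) M] [IsManifold (𝓡 4) ∞ M], M ≃ₕ (Metric.sphere (0 : EuclideanSpace ℝ (Fin 5)) 1) → ∀ T : Fin 3 → Set M, IsGKTrisection M 3 (fun _ => 1) T → ∀ f : Fin 3 → Set M, ((∀ i, IsCurve T (f i)) ∧ (Pairwise fun i j => Disjoint (f i) (f j)) ∧ (∀ i, IsNonSeparating T (f i)) ∧ (∀ i, BoundsDisc T (spineHandlebody T i) (f i)) ∧ (∀ i j, i ≠ j → IsConnected (centralSurfaceSet T \ (f i ∪ f j))) ∧ ¬ IsPreconnected (centralSurfaceSet T \ ⋃ i, f i)) → ¬ IsWeaklyReducible T → ∃ (X' : Type) (_ : TopologicalSpace X') (_ : T2Space X') (_ : SecondCountableTopology X') (_ : ChartedSpace (EuclideanSpace ℝ (Fin 4)) X') (_ : IsManifold (𝓡 4) ∞ X') (g' : ℕ) (k' : Fin 3 → ℕ) (T' : Fin 3 → Set X') (ℓ : Metric.sphere (0 : EuclideanSpace ℝ (Fin 2)) 1 → X'), g' ≤ 2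 ∧ IsGKTrisection X' g' k' T' ∧ IsCircleSurgery (𝓡 4) (𝓡 4) X' M ℓ) →
    Summit.SmoothPoincare4.SmoothPoincare4.Theses.WeakReductionDescent.DependentTripleGenusThreeStandard := by
  intro h1 h2 h3a h3b h4
  exact helper_dependentTripleGenusThreeStandard_of_four h1 h2
    (helper_separatingPairWeaklyReducible_of_stubs h3a h3b) h4

end Summit.SmoothPoincare4.SmoothPoincare4.Theorems

end
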